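import Summits.CriticalPhenomena.PercolationContinuityZ3.Theorems.PercNearOneGluingNoHeavyLowerTailSunflowerBernsteinCertificate
import Summits.CriticalPhenomena.PercolationContinuityZ3.Theorems.PercNearOneGluingNoHeavyLowerTailSunflowerSafePartition
import HarnessLib

/-!
# `NoHeavyLowerTail` (crux stmt-CriticalPhenomena-4575), abstract sunflower cubic: THE BERNSTEIN CHECKER MEETS `famIn`
# (hitting functions as dense polynomials; a certified safety inequality)

Support file (seat `prim-ineq-prove-1` gen 38; `--supports stmt-CriticalPhenomena-4575`).  No `sorry`, no named facts.
Memo: run/shared/lean/prim/prim-ineq-prove-1/FINDING-BERNSTEIN-prove1-g38.md §1, §5.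

SETTING.  The block is the whole cube `Fin n` (`univ`), a family is indexed by `C : Fin t → Finset (Fin n)` (think: the minimal
transversals of a core, `𝒯 = univ.image C`), and sub-families by their codes `u : Finset (Fin t)`.
* `wPoly T` — the cylinder weight `wmiss p univ T = ∏_{e∈T}(1−p_e) ∏_{e∉T} p_e` as a multi-affine `Bern.Poly n 1` (`eval_wPoly`);
* `famInPoly C u` — `famIn p univ (univ.image C) (u.image C)` as a multi-affine polynomial (**`famIn_image_eq_eval`**);
* `safetyArr C K u` — the TABLE of the polynomial `famIn(∅)^K · 1 − ∏_{i ≤ K} famIn(u i)` (degree `K+1`), `eval_safetyArr`, and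
  **`prod_famIn_le_of_certify`**: if `Bern.certifyA n (K+1) (safetyArr C K u) = true` then
  `∏_{i : Fin (K+1)} famIn p univ 𝒯 ((u i).image C) ≤ famIn p univ 𝒯 ∅ ^ K` for EVERY `p`;
* **`test_of_sorted`** — the hypothesis of `disjoint_famIn_of_nonempty` (…SunflowerSafePartition) for `𝒯 = univ.image C` follows
  from the certificates of the tuples of nonempty pairwise disjoint CODE sets sorted by their minima (`Tuple.sort`).
So finitely many compiled certificate checks give `∀ p, Safe p A` (first instances: the path core `P₅` and the pentagon `C₅`,
…SunflowerBernsteinPathFive / …SunflowerBernsteinPentagon).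
-/

namespace Summit.CriticalPhenomena.PercolationContinuityZ3.Theorems.SunflowerPartition

namespace SafeCalc

namespace Bern

open Finset
open Literature.Probability.LatticeModels Literature.Probability.Percolation
open TwoGenCore (wmiss)

variable {n t : ℕ}

/-! ## Cylinder weights and hitting functions as polynomials -/

/-- The per-coordinate coefficient of the cylinder weight: `1 − X` on `T`, `X` off `T`. [this work] -/
def wCoef (T : Finset (Fin n)) (i : Fin n) (m : Fin 2) : ℤ :=
  if i ∈ T then (if (m : ℕ) = 0 then 1 else -1) else (if (m : ℕ) = 1 then 1 else 0)

/-- The cylinder weight `∏_{e∈T}(1 − X_e) ∏_{e∉T} X_e` as a multi-affine polynomial. [this work] -/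
def wPoly (T : Finset (Fin n)) : Poly n 1 := fun e => ∏ i, wCoef T i (e i)

/-- The per-coordinate factor of the cylinder weight: `1 − x` on `T`, `x` off `T`. [this work] -/
theorem sum_wCoef (T : Finset (Fin n)) (i : Fin n) (x : ℝ) :
    ∑ m : Fin 2, (wCoef T i m : ℝ) * x ^ (m : ℕ) = if i ∈ T then 1 - x else x := by
  rw [Fin.sum_univ_two]
  by_cases hi : i ∈ T
  · simp [wCoef, hi]; ring
  · simp [wCoef, hi]

/-- Evaluation of the cylinder-weight polynomial. [this work] -/
theorem eval_wPoly (T : Finset (Fin n)) (x : Fin n → ℝ) :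
    eval (wPoly T) x = (∏ i ∈ T, (1 - x i)) * ∏ i ∈ univ \ T, x i := by
  classical
  simp only [eval, wPoly, mono, Int.cast_prod, ← prod_mul_distrib]
  rw [← Fintype.piFinset_univ, ← Finset.prod_univ_sum (fun _ => (univ : Finset (Fin 2)))
    (fun i (m : Fin 2) => (wCoef T i m : ℝ) * x i ^ (m : ℕ))]
  simp only [sum_wCoef]
  rw [prod_ite, filter_mem_eq_inter, univ_inter]
  congr 1
  refine prod_congr ?_ fun _ _ => rfl
  ext i; simp

/-- `wmiss p univ T` is the evaluation of `wPoly T` at `p`. [this work] -/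
theorem wmiss_eq_eval (p : Fin n → unitInterval) (T : Finset (Fin n)) :
    wmiss p univ T = eval (wPoly T) (fun i => (p i : ℝ)) := by
  rw [eval_wPoly]; rfl

variable (C : Fin t → Finset (Fin n))

/-- The hitting function `famIn p univ (univ.image C) (u.image C)` as a multi-affine polynomial (codes `u`). [this work] -/
def famInPoly (u : Finset (Fin t)) : Poly n 1 :=
  ∑ T : Finset (Fin n), if (∀ j, C j ⊆ T → j ∈ u) then wPoly T else 0

/-- **The hitting function is the evaluation of `famInPoly`** (for an injective indexing of the family). [this work] -/
theorem famIn_image_eq_eval (hC : Function.Injective C) (p : Fin n → unitInterval) (u : Finset (Fin t)) :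
    famIn p univ (univ.image C) (u.image C) = eval (famInPoly C u) (fun i => (p i : ℝ)) := by
  classical
  unfold famIn BEx famInPoly
  rw [eval_sum, powerset_univ]
  refine sum_congr rfl fun T _ => ?_
  have hcond : (∀ D ∈ univ.image C, D ⊆ T → D ∈ u.image C) ↔ (∀ j, C j ⊆ T → j ∈ u) := by
    simp only [mem_image, mem_univ, true_and, forall_exists_index, forall_apply_eq_imp_iff]
    refine forall_congr' fun j => imp_congr_right fun _ => ⟨?_, fun hj => ⟨j, hj, rfl⟩⟩
    rintro ⟨i, hi, hij⟩
    rwa [← hC hij]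
  dsimp only
  by_cases h : ∀ j, C j ⊆ T → j ∈ u
  · rw [if_pos (hcond.2 h), if_pos h, wmiss_eq_eval, mul_one]
  · rw [if_neg (fun h' => h (hcond.1 h')), if_neg h, mul_zero, eval_zero]

/-- The constant `1` as a multi-affine polynomial. [this work] -/
def onePoly : Poly n 1 := single (fun _ => 0) 1

/-- The constant `1` evaluates to `1`. [this work] -/
@[simp] theorem eval_onePoly (x : Fin n → ℝ) : eval (onePoly (n := n)) x = 1 := by
  rw [onePoly, eval_single]; simp [mono]

/-- The SAFETY POLYNOMIAL of a `(K+1)`-tuple of sub-family codes: `famIn(∅)^K · 1 − ∏_i famIn(u i)` (degree `K+1`). [this work] -/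
def safetyArr (K : ℕ) (u : Fin (K + 1) → Finset (Fin t)) : Array ℤ :=
  tabulate (ofTable n (K + 1) (prodFinA (n := n) (K + 1) fun i =>
      if (i : ℕ) < K then tabulate (famInPoly C ∅) else tabulate (onePoly (n := n))) -
    ofTable n (K + 1) (prodFinA (n := n) (K + 1) fun i => tabulate (famInPoly C (u i))))

/-- Evaluation of the safety polynomial. [this work] -/
theorem eval_safetyArr (hC : Function.Injective C) (p : Fin n → unitInterval) (K : ℕ)
    (u : Fin (K + 1) → Finset (Fin t)) :
    eval (ofTable n (K + 1) (safetyArr C K u)) (fun i => (p i : ℝ)) =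
      famIn p univ (univ.image C) ∅ ^ K - ∏ i, famIn p univ (univ.image C) ((u i).image C) := by
  rw [safetyArr, ofTable_tabulate, eval_sub, eval_prodFinA, eval_prodFinA, Fin.prod_univ_castSucc]
  have h1 : ∀ i : Fin K, eval (ofTable n 1 ((fun i : Fin (K + 1) =>
      if (i : ℕ) < K then tabulate (famInPoly C ∅) else tabulate (onePoly (n := n))) (Fin.castSucc i)))
      (fun i => (p i : ℝ)) = famIn p univ (univ.image C) ∅ := by
    intro i
    have : ((Fin.castSucc i : Fin (K + 1)) : ℕ) < K := by simp
    simp only [this, if_true, ofTable_tabulate]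
    rw [← image_empty C, famIn_image_eq_eval C hC]
  simp only [h1, prod_const, card_univ, Fintype.card_fin, Fin.val_last, lt_irrefl, if_false, ofTable_tabulate,
    eval_onePoly, mul_one]
  congr 1
  exact prod_congr rfl fun i _ => (famIn_image_eq_eval C hC p (u i)).symm

/-- **A certified safety inequality.**  If the safety polynomial passes the Bernstein certificate, then
`∏_i famIn(u i) ≤ famIn(∅)^K` for every product measure. [this work] -/
theorem prod_famIn_le_of_certify (hC : Function.Injective C) (p : Fin n → unitInterval) (K : ℕ)
    (u : Fin (K + 1) → Finset (Fin t)) (h : certifyA n (K + 1) (safetyArr C K u) = true) :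
    ∏ i, famIn p univ (univ.image C) ((u i).image C) ≤ famIn p univ (univ.image C) ∅ ^ K := by
  have hx : ∀ i : Fin n, 0 ≤ ((p i : unitInterval) : ℝ) ∧ ((p i : unitInterval) : ℝ) ≤ 1 :=
    fun i => ⟨(p i).2.1, (p i).2.2⟩
  have h0 := eval_nonneg_of_certifyA h hx
  rw [eval_safetyArr C hC] at h0
  linarith


/-! ## From sorted code tuples to the finite partition test -/

/-- **Reduction to sorted tuples of codes.**  To verify the hypothesis of `disjoint_famIn_of_nonempty` for the family
`univ.image C` it suffices to check, for each `k ≤ t`, the tuples of nonempty pairwise disjoint CODE sets `u i ⊆ Fin t` that are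
sorted by their minima (the product is symmetric, and disjoint nonempty sets have distinct minima). [this work] -/
theorem test_of_sorted (p : Fin n → unitInterval)
    (H : ∀ k, k ≤ t → ∀ u : Fin k → Finset (Fin t), (∀ i, (u i).Nonempty) → (∀ i j, i ≠ j → Disjoint (u i) (u j)) →
      (∀ i j : Fin k, i < j → (u i).min < (u j).min) →
      ∏ i, famIn p univ (univ.image C) ((u i).image C) ≤ famIn p univ (univ.image C) ∅ ^ (k - 1)) :
    ∀ k, k ≤ (univ.image C).card → ∀ 𝒰 : Fin k → Finset (Finset (Fin n)), (∀ i, 𝒰 i ⊆ univ.image C) →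
      (∀ i, (𝒰 i).Nonempty) → (∀ i j, i ≠ j → Disjoint (𝒰 i) (𝒰 j)) →
      ∏ i, famIn p univ (univ.image C) (𝒰 i) ≤ famIn p univ (univ.image C) ∅ ^ (k - 1) := by
  classical
  intro k hk 𝒰 hsub hne hdisj
  have hkt : k ≤ t := hk.trans (card_image_le.trans (by simp))
  -- codes of the sub-families
  let u : Fin k → Finset (Fin t) := fun i => univ.filter fun j => C j ∈ 𝒰 i
  have hU : ∀ i, 𝒰 i = (u i).image C := by
    intro i
    ext D
    simp only [u, mem_image, mem_filter, mem_univ, true_and]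
    constructor
    · intro hD
      obtain ⟨j, -, rfl⟩ := mem_image.1 (hsub i hD)
      exact ⟨j, hD, rfl⟩
    · rintro ⟨j, hj, rfl⟩; exact hj
  have hune : ∀ i, (u i).Nonempty := by
    intro i
    obtain ⟨D, hD⟩ := hne i
    rw [hU i, mem_image] at hD
    obtain ⟨j, hj, -⟩ := hD
    exact ⟨j, hj⟩
  have hud : ∀ i i', i ≠ i' → Disjoint (u i) (u i') := by
    intro i i' hii'
    rw [Finset.disjoint_left]
    intro j hj hj'
    simp only [u, mem_filter, mem_univ, true_and] at hj hj'
    exact Finset.disjoint_left.1 (hdisj i i' hii') hj hj'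
  -- sort by minima
  let σ := Tuple.sort fun i => (u i).min
  let u' : Fin k → Finset (Fin t) := fun i => u (σ i)
  have hmono : Monotone fun i => (u' i).min := Tuple.monotone_sort fun i => (u i).min
  have hsorted : ∀ i j : Fin k, i < j → (u' i).min < (u' j).min := by
    intro i j hij
    refine lt_of_le_of_ne (hmono hij.le) fun heq => ?_
    obtain ⟨a, ha⟩ := Finset.min_of_nonempty (hune (σ i))
    have ha' : (u' j).min = a := by rw [← heq]; exact ha
    have hai : a ∈ u (σ i) := Finset.mem_of_min ha
    have haj : a ∈ u (σ j) := Finset.mem_of_min ha'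
    have hne' : σ i ≠ σ j := fun h => (ne_of_lt hij) (σ.injective h)
    exact Finset.disjoint_left.1 (hud _ _ hne') hai haj
  have h := H k hkt u' (fun i => hune _) (fun i j hij => hud _ _ fun h => hij (σ.injective h)) hsorted
  calc ∏ i, famIn p univ (univ.image C) (𝒰 i) = ∏ i, famIn p univ (univ.image C) ((u i).image C) :=
        prod_congr rfl fun i _ => by rw [hU i]
    _ = ∏ i, famIn p univ (univ.image C) ((u' i).image C) :=
        (Equiv.prod_comp σ (fun i => famIn p univ (univ.image C) ((u i).image C))).symm
    _ ≤ famIn p univ (univ.image C) ∅ ^ (k - 1) := h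

end Bern

end SafeCalc

end Summit.CriticalPhenomena.PercolationContinuityZ3.Theorems.SunflowerPartition
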